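import Mathlib.RingTheory.Ideal.Height
import Mathlib.RingTheory.Ideal.KrullsHeightTheorem
import Mathlib.RingTheory.Localization.Finiteness
import Mathlib.RingTheory.Localization.Integer
import Mathlib.LinearAlgebra.FreeModule.PID
import Literature.RingTheory.IntegralClosure.KrullIntersection
import Literature.AlgebraicGeometry.Resolution.IdealIntegralClosureHeightOne
import Literature.AlgebraicGeometry.Resolution.RegularLocalRingsNormal
import Summits.ResolutionOfSingularities.ResolutionOfSingularities.Theorems.HomologicalConductorNoZenoReflexiveFreeRegular
import Summits.ResolutionOfSingularities.ResolutionOfSingularities.Theorems.HomologicalConductorNoZenoReflexiveHull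
import HarnessLib

/-!
# The reflexive hull: Krull's height-one criterion, agreement off the closed point, freeness
# (stalk input of G2 (iv) «the full sheaf is locally free» of chain W4.4)

`[OURS · L W4.4]` Crux `HomologicalConductor.NoZenoR` (stmt-ResolutionOfSingularities-19943; twin `NoZeno`
stmt-16483), line `sandwich-cluster`, S3 Layer 2, G-layer item **G2 (iv)** (owner res-D-pv-045 AS
res-L0-w44-stub-8; route «`M̃^{∨∨}/M̃` finitely supported»).  Sibling of `…ReflexiveHull.lean` (the hull
`reflexiveHull N ⊆ W` of a lattice `N` and `hull N ≅ N**`).  Here: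

* `mem_reflexiveHull_of_forall_height_eq_one` — over a noetherian NORMAL domain a vector of `K·N` lying in
  every height-one localisation `N_P` lies in the hull (Krull, Matsumura Thm. 11.5 (ii); tree
  `Literature.RingTheory.IntegralClosure.exists_algebraMap_eq_of_forall_height_eq_one`);
* `exists_lattice_of_height_eq_one` — at a height-one prime `𝔮` of a noetherian normal domain (`S_𝔮` a
  DVR), a finitely generated `N ⊆ W` is FREE UP TO `𝔮`-SATURATION: a linearly independent finite family
  `y` in `N` and `u ∉ 𝔮` with `u • N ⊆ ⊕ S yᵢ` (the localisation `N_𝔮` is free over the DVR);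
* `exists_smul_mem_of_mem_reflexiveHull_of_height_le_one` — **the hull agrees with `N` at every prime of
  height `≤ 1`**: `w ∈ hull N ⇒ u • w ∈ N` for some `u ∉ 𝔮`;
* `exists_smul_mem_of_mem_reflexiveHull_of_ne_maximalIdeal` — over a REGULAR local ring of Krull
  dimension `≤ 2`: the hull agrees with `N` at every prime `𝔮 ≠ 𝔪` («`M̃^{∨∨}/M̃` is supported at the
  closed point»);
* `free_reflexiveHull_of_isRegularLocalRing` — and the hull is a finite FREE module there
  (`hull N ≅ N**` + (F0)-dual `free_dual_of_isRegularLocalRing`, p498776).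

Replaces the role of no printed item of the manuscript under review (Hironaka 2017); textbook
commutative algebra; AI-written, weaker than expert review.
[cite: Matsumura1987, Thm. 11.5 (ii)]; [cite: BrunsHerzog1998, Prop. 1.4.1]
-/

-- single-problem summit: the doubled namespace component `ResolutionOfSingularities` is forced
set_option linter.dupNamespace false

noncomputable section

open Module IsLocalRing

universe u v

namespace Summit.ResolutionOfSingularities.ResolutionOfSingularities.Theorems.NoZeno.SandwichCluster

/-! ### Krull: vectors in every height-one localisation lie in the hull -/

section Krull

variable {S : Type u} [CommRing S] [IsDomain S] [IsNoetherianRing S] [IsIntegrallyClosed S]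
variable {W : Type v} [AddCommGroup W] [Module S W]

/-- Over a noetherian NORMAL domain: if `s₀ • v ∈ N` (`s₀ ≠ 0`) and for every height-one prime `P`
some `s ∉ P` has `s • v ∈ N`, then `v` lies in the reflexive hull of `N` — for `φ ∈ N*` the fraction
`φ(s₀ v)/s₀` lies in every `S_P`, hence in `S` (Matsumura Thm. 11.5 (ii), tree
`exists_algebraMap_eq_of_forall_height_eq_one`). [cite: Matsumura1987, Thm. 11.5 (ii)] -/
theorem mem_reflexiveHull_of_forall_height_eq_one (N : Submodule S W) {v : W} {s₀ : S} (hs₀ : s₀ ≠ 0)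
    (hv₀ : s₀ • v ∈ N) (h : ∀ P : Ideal S, P.IsPrime → P.height = 1 → ∃ s ∉ P, s • v ∈ N) :
    v ∈ reflexiveHull N := by
  classical
  let K := FractionRing S
  have hinj : Function.Injective (algebraMap S K) := IsFractionRing.injective S K
  have hs₀K : algebraMap S K s₀ ≠ 0 := IsFractionRing.to_map_eq_zero_iff.not.mpr hs₀
  refine (mem_reflexiveHull_iff_forall_dvd N hs₀ ⟨s₀ • v, hv₀⟩ rfl).2 fun φ => ?_
  obtain ⟨t, ht⟩ := Literature.RingTheory.IntegralClosure.exists_algebraMap_eq_of_forall_height_eq_one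
    (R := S) (K := K) (algebraMap S K (φ ⟨s₀ • v, hv₀⟩) / algebraMap S K s₀) (fun P hP hP1 => by
      obtain ⟨s, hsP, hsv⟩ := h P hP hP1
      refine ⟨s, hsP, φ ⟨s • v, hsv⟩, ?_⟩
      rw [mul_div_assoc', div_eq_iff hs₀K, ← map_mul, ← map_mul]
      congr 1
      have h1 : s • (⟨s₀ • v, hv₀⟩ : N) = s₀ • (⟨s • v, hsv⟩ : N) := by
        apply Subtype.ext
        change s • (s₀ • v) = s₀ • (s • v)
        rw [smul_smul, smul_smul, mul_comm]
      calc s * φ ⟨s₀ • v, hv₀⟩ = φ (s • ⟨s₀ • v, hv₀⟩) := by rw [map_smul, smul_eq_mul]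
        _ = φ (s₀ • ⟨s • v, hsv⟩) := by rw [h1]
        _ = φ ⟨s • v, hsv⟩ * s₀ := by rw [map_smul, smul_eq_mul, mul_comm])
  refine ⟨t, hinj ?_⟩
  rw [map_mul, ht, mul_div_cancel₀ _ hs₀K]

end Krull

/-! ### Coordinates on a lattice -/

section Coord

variable {S : Type u} [CommRing S]
variable {W : Type v} [AddCommGroup W] [Module S W]

/-- Coordinate functionals of a lattice: if `y` is a linearly independent finite family in `N` and
`u • N ⊆ ⊕ S yᵢ`, there are functionals `cᵢ ∈ N*` with `u • n = Σ cᵢ(n) • yᵢ` for all `n ∈ N`.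
[cite: BrunsHerzog1998, Prop. 1.4.1 (folklore)] -/
theorem exists_dual_smul_eq_sum (N : Submodule S W) {ι : Type*} [Fintype ι] {y : ι → N}
    (hli : LinearIndependent S y) {u : S} (hu : ∀ n : N, u • n ∈ Submodule.span S (Set.range y)) :
    ∃ c : ι → Module.Dual S N, ∀ n : N, u • n = ∑ i, c i n • y i := by
  classical
  let ρ : N →ₗ[S] Submodule.span S (Set.range y) :=
    LinearMap.codRestrict _ (u • LinearMap.id) fun n => hu n
  refine ⟨fun i => (Finsupp.lapply i) ∘ₗ hli.repr ∘ₗ ρ, fun n => ?_⟩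
  have h1 := hli.linearCombination_repr (ρ n)
  rw [Finsupp.linearCombination_apply, Finsupp.sum_fintype _ _ (fun i => by simp)] at h1
  simpa [ρ] using h1.symm

end Coord

/-! ### Height-one primes: the hull agrees with `N` -/

section HeightOne

variable {S : Type u} [CommRing S] [IsDomain S] [IsNoetherianRing S] [IsIntegrallyClosed S]
variable {W : Type v} [AddCommGroup W] [Module S W] [NoZeroSMulDivisors S W]

/-- **Free up to `𝔮`-saturation.**  `S` a noetherian normal domain, `𝔮` a prime of height one (so `S_𝔮`
is a discrete valuation ring), `N` a finitely generated submodule of a torsion-free module.  Then there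
are a finite linearly independent family `y` in `N` and `u ∉ 𝔮` with `u • N ⊆ ⊕ S yᵢ`: the localisation
`N_𝔮` is a finitely generated torsion-free module over the principal ideal domain `S_𝔮`, hence free, on a
basis of numerators. [cite: Matsumura1987, Thm. 11.5 and Cor. (p. 82)];
[cite: BrunsHerzog1998, Prop. 1.4.1 (folklore)] -/
theorem exists_lattice_of_height_eq_one (𝔮 : Ideal S) [𝔮.IsPrime] (h𝔮 : 𝔮.height = 1)
    (N : Submodule S W) [Module.Finite S N] :
    ∃ (ι : Type (max u v)) (_ : Fintype ι) (y : ι → N), LinearIndependent S y ∧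
      ∃ u ∉ 𝔮, ∀ n : N, u • n ∈ Submodule.span S (Set.range y) := by
  classical
  let P := 𝔮.primeCompl
  let Sq := Localization.AtPrime 𝔮
  let Nq := LocalizedModule P N
  let f : N →ₗ[S] Nq := LocalizedModule.mkLinearMap P N
  haveI : IsDiscreteValuationRing Sq :=
    Literature.AlgebraicGeometry.Resolution.Hironaka2005.isDiscreteValuationRing_of_height_eq_one 𝔮 h𝔮 Sq
  haveI : Module.IsTorsionFree S N := inferInstance
  haveI : Module.Free Sq Nq := Module.free_of_finite_type_torsion_free'
  let b := Module.Free.chooseBasis Sq Nq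
  let ι := Module.Free.ChooseBasisIndex Sq Nq
  haveI : Fintype ι := Module.Free.ChooseBasisIndex.fintype Sq Nq
  -- numerators of the basis vectors
  have hnum : ∀ i : ι, ∃ (m : N) (s : P), (s : S) • b i = f m := fun i => by
    obtain ⟨⟨m, s⟩, h⟩ := IsLocalizedModule.surj P f (b i)
    exact ⟨m, s, h⟩
  choose m s hms using hnum
  -- the numerators `f (m i) = sᵢ • bᵢ` form a basis of `N_𝔮` (unit multiples of `b`)
  have hunit : ∀ i, IsUnit (algebraMap S Sq (s i)) := fun i => IsLocalization.map_units Sq (s i)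
  have hfm : ∀ i, f (m i) = (hunit i).unit • b i := fun i => by
    rw [← hms i, Units.smul_def, IsUnit.unit_spec, algebraMap_smul]
  have hliq : LinearIndependent Sq (fun i => f (m i)) := by
    have : (fun i => f (m i)) = (fun i => (hunit i).unit) • (b : ι → Nq) := by
      ext i; rw [hfm i]; rfl
    rw [this]
    exact b.linearIndependent.units_smul _
  have hinjq : Function.Injective (algebraMap S Sq) :=
    IsLocalization.injective Sq 𝔮.primeCompl_le_nonZeroDivisors
  have hli : LinearIndependent S m := by
    refine LinearIndependent.of_comp f ?_
    refine hliq.restrict_scalars ?_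
    intro r r' h
    apply hinjq
    simpa [Algebra.smul_def] using h
  refine ⟨ι, inferInstance, m, hli, ?_⟩
  -- every `n ∈ N` has `c • n ∈ ⊕ S mᵢ` for some `c ∉ 𝔮`
  let b' : Basis ι Sq Nq := b.unitsSMul fun i => (hunit i).unit
  have hb' : ∀ i, b' i = f (m i) := fun i => by rw [Basis.unitsSMul_apply, hfm i]
  have hsat : ∀ n : N, ∃ c : S, c ∉ 𝔮 ∧ c • n ∈ Submodule.span S (Set.range m) := by
    intro n
    -- clear the denominators of the coordinates of `f n`
    obtain ⟨t, ht⟩ := IsLocalization.exist_integer_multiples_of_finite P (fun i => b'.repr (f n) i)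
    choose a ha using ht
    have hsum : f ((t : S) • n) = f (∑ i, a i • m i) := by
      have h1 := b'.linearCombination_repr (f n)
      rw [Finsupp.linearCombination_apply, Finsupp.sum_fintype _ _ (fun i => by simp)] at h1
      rw [map_smul, map_sum, ← h1, Finset.smul_sum]
      refine Finset.sum_congr rfl fun i _ => ?_
      rw [map_smul, ← hb' i, ← algebraMap_smul Sq (a i), ha i, smul_assoc]
    obtain ⟨c, hc⟩ := (IsLocalizedModule.eq_iff_exists P f).mp hsum
    refine ⟨(c : S) * t, ?_, ?_⟩
    · exact fun hmem => ((Ideal.IsPrime.mem_or_mem ‹𝔮.IsPrime› hmem).elim c.2 t.2)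
    · rw [mul_smul]
      change (c : S) • (t : S) • n ∈ _
      have : (c : S) • (t : S) • n = (c : S) • ∑ i, a i • m i := hc
      rw [this]
      exact Submodule.smul_mem _ _ (Submodule.sum_mem _ fun i _ =>
        Submodule.smul_mem _ _ (Submodule.subset_span ⟨i, rfl⟩))
  -- uniformly on a finite generating family
  obtain ⟨k, g, hg⟩ := Module.Finite.exists_fin (R := S) (M := N)
  choose c hc𝔮 hcg using fun j : Fin k => hsat (g j)
  refine ⟨∏ j, c j, fun hmem => ?_, fun n => ?_⟩
  · obtain ⟨j, -, hj⟩ := Ideal.IsPrime.prod_mem_iff.mp hmem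
    exact hc𝔮 j hj
  · obtain ⟨r, rfl⟩ : ∃ r : Fin k →₀ S, Finsupp.linearCombination S g r = n := by
      have : n ∈ Submodule.span S (Set.range g) := by rw [hg]; trivial
      exact Finsupp.mem_span_range_iff_exists_finsupp.mp this
    rw [Finsupp.linearCombination_apply, Finsupp.smul_sum]
    refine Submodule.sum_mem _ fun j _ => ?_
    dsimp only
    rw [smul_smul, mul_comm, mul_smul]
    refine Submodule.smul_mem _ _ ?_
    obtain ⟨d, hd⟩ : c j ∣ ∏ i, c i := Finset.dvd_prod_of_mem c (Finset.mem_univ j)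
    rw [hd, mul_comm, mul_smul]
    exact Submodule.smul_mem _ _ (hcg j)

/-- **The hull agrees with `N` at every prime of height `≤ 1`.**  `S` a noetherian normal domain,
`N ⊆ W` finitely generated, `W` torsion-free, `𝔮` a prime of height `≤ 1`: every `w ∈ hull N` has
`u • w ∈ N` for some `u ∉ 𝔮` (i.e. `(hull N)_𝔮 = N_𝔮`: over the DVR `S_𝔮` the free module `N_𝔮` is
reflexive). [cite: BrunsHerzog1998, Prop. 1.4.1]; [cite: Matsumura1987, Thm. 11.5] -/
theorem exists_smul_mem_of_mem_reflexiveHull_of_height_le_one (𝔮 : Ideal S) [𝔮.IsPrime]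
    (h𝔮 : 𝔮.height ≤ 1) (N : Submodule S W) [Module.Finite S N] {w : W} (hw : w ∈ reflexiveHull N) :
    ∃ u ∉ 𝔮, u • w ∈ N := by
  classical
  rcases eq_or_lt_of_le h𝔮 with h1 | h0
  · -- height one
    obtain ⟨ι, _, y, hli, u, hu𝔮, huN⟩ := exists_lattice_of_height_eq_one 𝔮 h1 N
    obtain ⟨c, hc⟩ := exists_dual_smul_eq_sum N hli huN
    obtain ⟨s, hs, ⟨n₀, hn₀⟩, -⟩ := id hw
    have hdiv : ∀ i, s ∣ c i n₀ := fun i => dvd_apply_of_mem_reflexiveHull N hw hn₀ (c i)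
    choose t ht using hdiv
    let n₁ : N := ∑ i, t i • y i
    have hun₀ : u • n₀ = s • n₁ := by
      rw [hc n₀, Finset.smul_sum]
      exact Finset.sum_congr rfl fun i _ => by rw [ht i, mul_smul]
    refine ⟨u, hu𝔮, ?_⟩
    have hV : s • (u • w) = s • (n₁ : W) := by
      rw [smul_comm, ← hn₀]
      have := congrArg (fun m : N => (m : W)) hun₀
      simpa using this
    rw [smul_right_injective W hs hV]
    exact n₁.2
  · -- height zero: `𝔮 = ⊥`
    have h0' : 𝔮.height = 0 := Order.lt_one_iff.mp h0
    have hbot : 𝔮 = ⊥ := Ideal.height_eq_zero_iff_eq_bot.mp h0'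
    obtain ⟨s, hs, hsw⟩ := exists_smul_mem_of_mem_reflexiveHull N hw
    exact ⟨s, by rw [hbot, Submodule.mem_bot]; exact hs, hsw⟩

end HeightOne

/-! ### Regular local rings of dimension `≤ 2`: support at the closed point, freeness -/

section Regular

variable {S : Type u} [CommRing S] [IsDomain S] [IsRegularLocalRing S]
variable {W : Type v} [AddCommGroup W] [Module S W] [NoZeroSMulDivisors S W]

/-- **`hull N / N` is supported at the closed point.**  Over a REGULAR local ring `S` of Krull dimension
`≤ 2` (a normal noetherian domain whose non-maximal primes have height `≤ 1`; `[IsDomain S]` is the tree's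
`isDomain_of_isRegularLocalRing`, taken as an instance argument so that `reflexiveHull` elaborates), for `N ⊆ W` finitely
generated and `W` torsion-free: every `w ∈ hull N` has `u • w ∈ N` for some `u ∉ 𝔮`, for every prime
`𝔮 ≠ 𝔪` — the stalk form of «`M̃^{∨∨}/M̃` has finite support» in THEOREM Q-rat (B1).
[cite: BrunsHerzog1998, Prop. 1.4.1]; [cite: Matsumura1987, Thm. 19.4] -/
theorem exists_smul_mem_of_mem_reflexiveHull_of_ne_maximalIdeal (hdim : ringKrullDim S ≤ 2)
    (𝔮 : Ideal S) [𝔮.IsPrime] (hne : 𝔮 ≠ maximalIdeal S) (N : Submodule S W) [Module.Finite S N]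
    {w : W} (hw : w ∈ reflexiveHull N) : ∃ u ∉ 𝔮, u • w ∈ N := by
  haveI := Literature.AlgebraicGeometry.Resolution.isIntegrallyClosed_of_isRegularLocalRing S
  refine exists_smul_mem_of_mem_reflexiveHull_of_height_le_one 𝔮 ?_ N hw
  -- `height 𝔮 + 1 ≤ height 𝔪 = dim S ≤ 2`
  have hlt : 𝔮 < maximalIdeal S :=
    lt_of_le_of_ne (IsLocalRing.le_maximalIdeal Ideal.IsPrime.ne_top') hne
  have h1 : 𝔮.height + 1 ≤ (maximalIdeal S).height := Ideal.height_add_one_le_of_lt_of_isPrime hlt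
  have h2 : ((maximalIdeal S).height : WithBot ℕ∞) ≤ 2 := by
    rw [IsLocalRing.maximalIdeal_height_eq_ringKrullDim]; exact hdim
  have h2' : (maximalIdeal S).height ≤ 2 := by
    rw [← WithBot.coe_le_coe, WithBot.coe_ofNat]; exact h2
  have h3 : 𝔮.height + 1 ≤ 1 + 1 := h1.trans h2'
  exact (ENat.add_le_add_iff_right ENat.one_ne_top).mp h3

end Regular

section Free

variable {S : Type u} [CommRing S] [IsDomain S] [IsRegularLocalRing S]
variable {W : Type u} [AddCommGroup W] [Module S W] [NoZeroSMulDivisors S W]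

/-- **The hull is free.**  Over a REGULAR local ring of Krull dimension `≤ 2`, the reflexive hull of a
finitely generated lattice `N` in a `K`-vector space is a (finite) FREE `S`-module: it is the double dual
`N**` (`reflexiveHullEquiv`), the dual of the finite module `N*`, free by (F0)
(`free_dual_of_isRegularLocalRing`). [cite: BrunsHerzog1998, Prop. 1.4.1 and Thm. 2.2.7] -/
theorem free_reflexiveHull_of_isRegularLocalRing (K : Type*) [Field K] [Algebra S K] [FaithfulSMul S K]
    [Module K W] [IsScalarTower S K W] (hdim : ringKrullDim S ≤ 2) (N : Submodule S W)
    [Module.Finite S N] : Module.Free S (reflexiveHull N) := by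
  haveI : Module.Finite S (Module.Dual S N) := Module.IsNoetherian.finite S _
  haveI : Module.Free S (Module.Dual S (Module.Dual S N)) :=
    free_dual_of_isRegularLocalRing hdim (Module.Dual S N)
  exact Module.Free.of_equiv (reflexiveHullEquiv (K := K) N).symm

/-- Over a regular local ring of dimension `≤ 2` the hull of a finitely generated lattice in a vector space
is finite, free and REFLEXIVE. [cite: BrunsHerzog1998, Prop. 1.4.1] -/
theorem isReflexive_reflexiveHull_of_isRegularLocalRing (K : Type*) [Field K] [Algebra S K]
    [FaithfulSMul S K] [Module K W] [IsScalarTower S K W] (hdim : ringKrullDim S ≤ 2)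
    (N : Submodule S W) [Module.Finite S N] : Module.IsReflexive S (reflexiveHull N) := by
  haveI := free_reflexiveHull_of_isRegularLocalRing K hdim N
  haveI := finite_reflexiveHull (K := K) N
  infer_instance

end Free

end Summit.ResolutionOfSingularities.ResolutionOfSingularities.Theorems.NoZeno.SandwichCluster

end
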